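/-
Copyright (c) 2026. All rights reserved.
Released under Apache 2.0 license as described in the file LICENSE.
-/
import Summits.Langlands.Langlands.Theorems.SoloInformedBmaxRationalInvariants
import HarnessLib

/-!
# `B_max(F)^{Γ_F} ⊆ F`: the de Rham bound on the Galois invariants of `B_max(F) = A_max[1/t]`

Solo/informed seat, programme Λ, file Λ4 (the twisted layers `a/tᵏ` of `B_max(F)`, up to the field `F`).  Files Λ2/Λ3
(`SpecC.forall_galBmaxPlus_iff`, `SpecC.forall_galBmax_iff_of_isPIntegral`) compute the `Γ_F`-invariants of the
`p`-integral part `B_max⁺(F) = A_max[1/p]` of the constructed ring `D2Cris.Bmax F p = A_max[1/t]` exactly (`= K₀`).  For a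
GENERAL element `y = a/tᵏ` this file proves the de Rham bound:

* `bmaxToFracBdR` — the comparison **`B_max(F) = A_max[1/t] → B_dR(F) = Frac B_dR⁺(F)`** extending Colmez's
  `bmaxPlusToBdR : A_max → B_dR⁺` (`t ↦ t_dR ≠ 0`); `bmaxToFracBdR_algebraMap`, `bmaxToFracBdR_injective`;
* `smul_bmaxToFracBdR` — it is `Γ_F`-equivariant;
* ★ `forall_galBmax_iff_mem_range` — **`y ∈ B_max(F)` is `Γ_F`-invariant iff its image in `B_dR(F)` lies in (the image of)
  `F`**, i.e. `B_max(F)^{Γ_F} = B_max(F) ∩ F` inside `B_dR(F)` (`B_dR(F)^{Γ_F} = F`, tree `fixedPoints_fracBdR_eq_range`);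
* `existsUnique_field_of_forall_galBmax`, `invariantToField` — the resulting INJECTIVE map `B_max(F)^{Γ_F} ↪ F`
  (additive and multiplicative: `invariantToField_add`, `invariantToField_mul`, `invariantToField_injective`);
* `exists_field_mul_tBdR_pow_of_twisted` — the twisted layers in de Rham form: if `σ a · tᵏ = a · (σ t)ᵏ` in `A_max`
  (i.e. `a` transforms by `χᵏ`), then `a = c · t_dRᵏ` in `B_dR(F)` for some `c ∈ F`.

What remains of input (I2) `B_max(F)^{Γ_F} = F₀` after this file is exactly `F ∩ B_max(F) = F₀` inside `B_dR(F)` — the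
content of the fundamental injectivity `F ⊗_{F₀} B_max⁺ ↪ B_dR⁺` (Fontaine, Astérisque 223, Exp. II §4.1.2–4.1.3, whose proof is
incomplete for `e(F) > 1` according to Brinon–Conrad, CMI notes, proof of Thm. 9.1.5; not in the tree); it is empty when
`e(F/ℚ_p) = 1`.

References: Colmez, Ann. of Math. 148 (1998), §III.2; Fontaine, Astérisque 223 (1994), Exp. II §1.5, Exp. III §4.1;
Brinon–Conrad, CMI Summer School notes on p-adic Hodge theory (2009), Thm. 9.1.5.
-/

noncomputable section

open WittVector Field IsLocalRing ValuativeRel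
open Literature.NumberTheory.GaloisRepresentations Literature.NumberTheory.PAdicHodge
open Literature.NumberTheory.GaloisRepresentations.IsNonarchimedeanLocalField

namespace Summit.Langlands.Langlands.Theorems

namespace SpecC

variable {F : Type} [Field F] [ValuativeRel F] [TopologicalSpace F] [IsNonarchimedeanLocalField F] [CharZero F]
  {p : ℕ} [Fact p.Prime] [Fact (¬ IsUnit (p : integerC F))] [IsAdicComplete (Ideal.span {(p : integerC F)}) (integerC F)]

/-! ### §1 The comparison `B_max(F) → B_dR(F)` -/

/-- The image `t_dR` of `t` under `A_max → B_dR⁺ → B_dR` is a unit of the field `B_dR(F)`. [cite: Colmez1998Annals, §III.2] -/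
theorem isUnit_algebraMap_bmaxPlusToBdR_tBmax (hF : Function.Surjective (fontaineTheta (integerC F) p)) :
    IsUnit (((algebraMap (BDeRhamPlus (integerC F) p) (FracBdR F p)).comp (bmaxPlusToBdR F p))
      (tBmax (F := F) (p := p))) := by
  haveI := isDomain_bDeRhamPlus (F := F) (p := p) hF
  rw [RingHom.comp_apply, bmaxPlusToBdR_tBmax]
  exact isUnit_iff_ne_zero.2 ((map_ne_zero_iff _ algebraMap_fracBdR_injective).2 (tBdR_ne_zero hF))

/-- **The comparison `B_max(F) = A_max[1/t] → B_dR(F) = Frac B_dR⁺(F)`**, the unique extension of Colmez's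
`bmaxPlusToBdR : A_max → B_dR⁺` (`t` becomes invertible in the field `B_dR(F)`). [cite: Colmez1998Annals, §III.2]
[cite: FontaineAsterisque223III, Exp. III §4.1] -/
def bmaxToFracBdR (hF : Function.Surjective (fontaineTheta (integerC F) p)) : D2Cris.Bmax F p →+* FracBdR F p :=
  IsLocalization.Away.lift (S := D2Cris.Bmax F p) (tBmax (F := F) (p := p))
    (isUnit_algebraMap_bmaxPlusToBdR_tBmax hF)

/-- `bmaxToFracBdR` extends `bmaxPlusToBdR`. [folklore] -/
theorem bmaxToFracBdR_algebraMap (hF : Function.Surjective (fontaineTheta (integerC F) p)) (x : BmaxPlus F p) :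
    bmaxToFracBdR hF (algebraMap (BmaxPlus F p) (D2Cris.Bmax F p) x) =
      algebraMap (BDeRhamPlus (integerC F) p) (FracBdR F p) (bmaxPlusToBdR F p x) :=
  IsLocalization.Away.lift_eq _ _ _

/-- `bmaxToFracBdR ∘ (A_max → A_max[1/t]) = (B_dR⁺ → B_dR) ∘ bmaxPlusToBdR`. [folklore] -/
theorem bmaxToFracBdR_comp_algebraMap (hF : Function.Surjective (fontaineTheta (integerC F) p)) :
    (bmaxToFracBdR hF).comp (algebraMap (BmaxPlus F p) (D2Cris.Bmax F p)) =
      (algebraMap (BDeRhamPlus (integerC F) p) (FracBdR F p)).comp (bmaxPlusToBdR F p) :=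
  RingHom.ext fun x => bmaxToFracBdR_algebraMap hF x

/-- `bmaxToFracBdR` on `t`: the image of `t ∈ A_max[1/t]` is `t_dR`. [cite: Colmez1998Annals, §III.2] -/
theorem bmaxToFracBdR_tBmax (hF : Function.Surjective (fontaineTheta (integerC F) p)) :
    bmaxToFracBdR hF (algebraMap (BmaxPlus F p) (D2Cris.Bmax F p) tBmax) =
      algebraMap (BDeRhamPlus (integerC F) p) (FracBdR F p) tBdR := by
  rw [bmaxToFracBdR_algebraMap, bmaxPlusToBdR_tBmax]

/-- **`B_max(F) → B_dR(F)` is injective** (`A_max ↪ B_dR⁺ ↪ B_dR` and `t ≠ 0`). [cite: Colmez1998Annals, §III.2] -/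
theorem bmaxToFracBdR_injective (hF : Function.Surjective (fontaineTheta (integerC F) p)) :
    Function.Injective (bmaxToFracBdR (F := F) (p := p) hF) := by
  haveI := isDomain_bDeRhamPlus (F := F) (p := p) hF
  refine (injective_iff_map_eq_zero _).2 fun y hy => ?_
  obtain ⟨⟨x, s⟩, hxs⟩ := IsLocalization.surj (Submonoid.powers (tBmax (F := F) (p := p))) y
  obtain ⟨n, hn⟩ := (Submonoid.mem_powers_iff _ _).1 s.2
  -- `y · tⁿ = x`, so `x ↦ 0` in `B_dR`, hence `x = 0`, hence `y = 0`
  have hx0 : algebraMap (BDeRhamPlus (integerC F) p) (FracBdR F p) (bmaxPlusToBdR F p x) = 0 := by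
    rw [← bmaxToFracBdR_algebraMap hF, ← hxs, map_mul, hy, zero_mul]
  have hx : x = 0 :=
    bmaxPlusToBdR_injective hF (by rw [map_zero]; exact algebraMap_fracBdR_injective (by rw [map_zero]; exact hx0))
  have hs : IsUnit (algebraMap (BmaxPlus F p) (D2Cris.Bmax F p) (s : BmaxPlus F p)) := by
    rw [← hn, map_pow]; exact (D2Cris.isUnit_algebraMap_tBmax (F := F) (p := p)).pow n
  rw [hx, map_zero] at hxs
  exact hs.mul_left_eq_zero.1 hxs

/-! ### §2 `Γ_F`-equivariance -/

/-- **`Γ_F`-equivariance of `B_max(F) → B_dR(F)`**: `σ • bmaxToFracBdR y = bmaxToFracBdR (σ y)` (both sides are ring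
homomorphisms out of the localisation `A_max[1/t]` agreeing on `A_max`, by `galBdRPlus_bmaxPlusToBdR`).
[cite: Colmez1998Annals, §III.2] -/
theorem smul_bmaxToFracBdR (hF : Function.Surjective (fontaineTheta (integerC F) p)) (σ : absoluteGaloisGroup F)
    (y : D2Cris.Bmax F p) :
    σ • bmaxToFracBdR hF y = bmaxToFracBdR hF (D2Cris.galBmax σ y) := by
  have key : (MulSemiringAction.toRingHom (absoluteGaloisGroup F) (FracBdR F p) σ).comp (bmaxToFracBdR hF) =
      (bmaxToFracBdR hF).comp (D2Cris.galBmax (F := F) (p := p) σ) :=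
    IsLocalization.ringHom_ext (Submonoid.powers (tBmax (F := F) (p := p))) <| by
      ext x
      simp only [RingHom.comp_apply, MulSemiringAction.toRingHom_apply, D2Cris.galBmax_algebraMap,
        bmaxToFracBdR_algebraMap, smul_algebraMap_fracBdR, galBdRPlus_bmaxPlusToBdR]
  simpa only [RingHom.comp_apply, MulSemiringAction.toRingHom_apply] using RingHom.congr_fun key y

/-! ### §3 The invariants: `B_max(F)^{Γ_F} = B_max(F) ∩ F` -/

section Invariants

variable (hp : valuation F p < 1) (hF : Function.Surjective (fontaineTheta (integerC F) p))

include hp in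
/-- ★ **`B_max(F)^{Γ_F} ⊆ F`**: an element `y` of the constructed `B_max(F) = A_max[1/t]` is `Γ_F`-invariant iff its
image in `B_dR(F)` lies in the image of `F` (`B_dR(F)^{Γ_F} = F` and `B_max(F) ↪ B_dR(F)` is `Γ_F`-equivariant and
injective).  Together with Λ3 (`forall_galBmax_iff_of_isPIntegral`: `= K₀` on `A_max[1/p]`) this leaves of input (I2)
exactly `F ∩ B_max(F) = F₀`. [cite: FontaineAsterisque223III, Exp. III §4.1] [cite: Colmez1998Annals, §III.2] -/
theorem forall_galBmax_iff_mem_range (y : D2Cris.Bmax F p) :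
    (∀ σ : absoluteGaloisGroup F, D2Cris.galBmax σ y = y) ↔
      bmaxToFracBdR hF y ∈ Set.range (letI := fracAlgebra (p := p) hp hF; algebraMap F (FracBdR F p)) := by
  haveI := isDomain_bDeRhamPlus (F := F) (p := p) hF
  constructor
  · intro hy
    have hmem : bmaxToFracBdR hF y ∈ {x : FracBdR F p | ∀ σ : absoluteGaloisGroup F, σ • x = x} := by
      intro σ
      rw [smul_bmaxToFracBdR, hy σ]
    rwa [fixedPoints_fracBdR_eq_range hp hF] at hmem
  · rintro ⟨c, hc⟩ σ
    apply bmaxToFracBdR_injective hF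
    rw [← smul_bmaxToFracBdR, ← hc]
    exact smul_algebraMap_fracAlgebra hp hF σ c

include hp in
/-- **A `Γ_F`-invariant `y ∈ B_max(F)` is the image of a UNIQUE `c ∈ F`** in `B_dR(F)`. [cite: FontaineAsterisque223III, Exp. III §4.1] -/
theorem existsUnique_field_of_forall_galBmax {y : D2Cris.Bmax F p} (hy : ∀ σ : absoluteGaloisGroup F, D2Cris.galBmax σ y = y) :
    ∃! c : F, algebraMap (BDeRhamPlus (integerC F) p) (FracBdR F p) (embBdRHom hp hF c) = bmaxToFracBdR hF y := by
  haveI := isDomain_bDeRhamPlus (F := F) (p := p) hF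
  obtain ⟨c, hc⟩ := (forall_galBmax_iff_mem_range hp hF y).1 hy
  have hc₁ : algebraMap (BDeRhamPlus (integerC F) p) (FracBdR F p) (embBdRHom hp hF c) = bmaxToFracBdR hF y := hc
  refine ⟨c, hc₁, fun c' hc' => ?_⟩
  have h : algebraMap (BDeRhamPlus (integerC F) p) (FracBdR F p) (embBdRHom hp hF c') =
      algebraMap (BDeRhamPlus (integerC F) p) (FracBdR F p) (embBdRHom hp hF c) := hc'.trans hc₁.symm
  exact (embBdRHom hp hF).injective (algebraMap_fracBdR_injective h)

/-- **The map `B_max(F)^{Γ_F} → F`**: the unique `c ∈ F` with the same image in `B_dR(F)` as the invariant `y`.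
[cite: FontaineAsterisque223III, Exp. III §4.1] -/
def invariantToField {y : D2Cris.Bmax F p} (hy : ∀ σ : absoluteGaloisGroup F, D2Cris.galBmax σ y = y) : F :=
  (existsUnique_field_of_forall_galBmax hp hF hy).exists.choose

include hp in
/-- Defining property of `invariantToField`: `embBdR (invariantToField y) = bmaxToFracBdR y` in `B_dR(F)`. [folklore] -/
theorem algebraMap_embBdRHom_invariantToField {y : D2Cris.Bmax F p}
    (hy : ∀ σ : absoluteGaloisGroup F, D2Cris.galBmax σ y = y) :
    algebraMap (BDeRhamPlus (integerC F) p) (FracBdR F p) (embBdRHom hp hF (invariantToField hp hF hy)) =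
      bmaxToFracBdR hF y :=
  (existsUnique_field_of_forall_galBmax hp hF hy).exists.choose_spec

include hp in
/-- Characterisation of `invariantToField`: `invariantToField y = c ↔ embBdR c = bmaxToFracBdR y`. [folklore] -/
theorem invariantToField_eq_iff {y : D2Cris.Bmax F p} (hy : ∀ σ : absoluteGaloisGroup F, D2Cris.galBmax σ y = y) (c : F) :
    invariantToField hp hF hy = c ↔
      algebraMap (BDeRhamPlus (integerC F) p) (FracBdR F p) (embBdRHom hp hF c) = bmaxToFracBdR hF y := by
  constructor
  · rintro rfl; exact algebraMap_embBdRHom_invariantToField hp hF hy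
  · intro hc
    exact ((existsUnique_field_of_forall_galBmax hp hF hy).unique (algebraMap_embBdRHom_invariantToField hp hF hy) hc)

include hp in
/-- **`B_max(F)^{Γ_F} → F` is injective.** [cite: FontaineAsterisque223III, Exp. III §4.1] -/
theorem invariantToField_injective {y y' : D2Cris.Bmax F p} (hy : ∀ σ : absoluteGaloisGroup F, D2Cris.galBmax σ y = y)
    (hy' : ∀ σ : absoluteGaloisGroup F, D2Cris.galBmax σ y' = y')
    (h : invariantToField hp hF hy = invariantToField hp hF hy') : y = y' := by
  apply bmaxToFracBdR_injective hF
  rw [← algebraMap_embBdRHom_invariantToField hp hF hy, ← algebraMap_embBdRHom_invariantToField hp hF hy', h]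

include hp in
/-- `B_max(F)^{Γ_F} → F` is additive. [folklore] -/
theorem invariantToField_add {y y' : D2Cris.Bmax F p} (hy : ∀ σ : absoluteGaloisGroup F, D2Cris.galBmax σ y = y)
    (hy' : ∀ σ : absoluteGaloisGroup F, D2Cris.galBmax σ y' = y')
    (hyy' : ∀ σ : absoluteGaloisGroup F, D2Cris.galBmax σ (y + y') = y + y') :
    invariantToField hp hF hyy' = invariantToField hp hF hy + invariantToField hp hF hy' := by
  rw [invariantToField_eq_iff, map_add, map_add, map_add, algebraMap_embBdRHom_invariantToField,
    algebraMap_embBdRHom_invariantToField]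

include hp in
/-- `B_max(F)^{Γ_F} → F` is multiplicative. [folklore] -/
theorem invariantToField_mul {y y' : D2Cris.Bmax F p} (hy : ∀ σ : absoluteGaloisGroup F, D2Cris.galBmax σ y = y)
    (hy' : ∀ σ : absoluteGaloisGroup F, D2Cris.galBmax σ y' = y')
    (hyy' : ∀ σ : absoluteGaloisGroup F, D2Cris.galBmax σ (y * y') = y * y') :
    invariantToField hp hF hyy' = invariantToField hp hF hy * invariantToField hp hF hy' := by
  rw [invariantToField_eq_iff, map_mul, map_mul, map_mul, algebraMap_embBdRHom_invariantToField,
    algebraMap_embBdRHom_invariantToField]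

include hp in
/-- `B_max(F)^{Γ_F} → F` sends `1` to `1`. [folklore] -/
theorem invariantToField_one (h1 : ∀ σ : absoluteGaloisGroup F, D2Cris.galBmax σ (1 : D2Cris.Bmax F p) = 1) :
    invariantToField hp hF h1 = 1 := by
  rw [invariantToField_eq_iff, map_one, map_one, map_one]

include hp in
/-- **The twisted layers, de Rham form**: if `a ∈ A_max` transforms by the `k`-th power of the character of `t`
(`σ a · tᵏ = a · (σ t)ᵏ` in `A_max`), then `a/tᵏ ∈ B_max(F)` is `Γ_F`-invariant, hence comes from `F`: there is
`c ∈ F` with `a = c · t_dRᵏ` in `B_dR(F)`. [cite: FontaineAsterisque223III, Exp. III §4.1] [cite: Colmez1998Annals, §III.2] -/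
theorem exists_field_mul_tBdR_pow_of_twisted {a : BmaxPlus F p} {k : ℕ}
    (ha : ∀ σ : absoluteGaloisGroup F, galBmaxPlus σ a * tBmax ^ k = a * galBmaxPlus σ tBmax ^ k) :
    ∃ c : F, algebraMap (BDeRhamPlus (integerC F) p) (FracBdR F p) (bmaxPlusToBdR F p a) =
      algebraMap (BDeRhamPlus (integerC F) p) (FracBdR F p) (embBdRHom hp hF c) *
        algebraMap (BDeRhamPlus (integerC F) p) (FracBdR F p) tBdR ^ k := by
  haveI := isDomain_bDeRhamPlus (F := F) (p := p) hF
  -- the invariant `y = a / tᵏ` of `B_max(F) = A_max[1/t]`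
  have hT : IsUnit (algebraMap (BmaxPlus F p) (D2Cris.Bmax F p) tBmax ^ k) :=
    (D2Cris.isUnit_algebraMap_tBmax (F := F) (p := p)).pow k
  obtain ⟨Tinv, hTinv⟩ := hT.exists_right_inv
  obtain ⟨y, hy_def⟩ : ∃ y : D2Cris.Bmax F p, y = algebraMap (BmaxPlus F p) (D2Cris.Bmax F p) a * Tinv := ⟨_, rfl⟩
  have hyt : y * algebraMap (BmaxPlus F p) (D2Cris.Bmax F p) tBmax ^ k =
      algebraMap (BmaxPlus F p) (D2Cris.Bmax F p) a := by
    rw [hy_def, mul_assoc, mul_comm Tinv, hTinv, mul_one]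
  have hy : ∀ σ : absoluteGaloisGroup F, D2Cris.galBmax σ y = y := by
    intro σ
    have hS : IsUnit (algebraMap (BmaxPlus F p) (D2Cris.Bmax F p) (galBmaxPlus σ tBmax) ^ k) := by
      have h := D2Cris.isUnit_galBmaxPlus_tBmax (F := F) (p := p) σ
      rw [RingHom.comp_apply] at h
      exact h.pow k
    have e1 : algebraMap (BmaxPlus F p) (D2Cris.Bmax F p) (galBmaxPlus σ a) *
          algebraMap (BmaxPlus F p) (D2Cris.Bmax F p) tBmax ^ k =
        algebraMap (BmaxPlus F p) (D2Cris.Bmax F p) a *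
          algebraMap (BmaxPlus F p) (D2Cris.Bmax F p) (galBmaxPlus σ tBmax) ^ k := by
      simpa only [map_mul, map_pow] using congrArg (algebraMap (BmaxPlus F p) (D2Cris.Bmax F p)) (ha σ)
    -- cancel `tᵏ`: `σ a = y · (σ t)ᵏ` in `B_max(F)` (term-mode steps only: no definitional unfolding of period elements)
    have e2 : algebraMap (BmaxPlus F p) (D2Cris.Bmax F p) (galBmaxPlus σ a) *
          algebraMap (BmaxPlus F p) (D2Cris.Bmax F p) tBmax ^ k =
        y * algebraMap (BmaxPlus F p) (D2Cris.Bmax F p) (galBmaxPlus σ tBmax) ^ k *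
          algebraMap (BmaxPlus F p) (D2Cris.Bmax F p) tBmax ^ k :=
      calc algebraMap (BmaxPlus F p) (D2Cris.Bmax F p) (galBmaxPlus σ a) *
            algebraMap (BmaxPlus F p) (D2Cris.Bmax F p) tBmax ^ k =
          algebraMap (BmaxPlus F p) (D2Cris.Bmax F p) a *
            algebraMap (BmaxPlus F p) (D2Cris.Bmax F p) (galBmaxPlus σ tBmax) ^ k := e1
        _ = y * algebraMap (BmaxPlus F p) (D2Cris.Bmax F p) tBmax ^ k *
            algebraMap (BmaxPlus F p) (D2Cris.Bmax F p) (galBmaxPlus σ tBmax) ^ k :=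
          congrArg (· * algebraMap (BmaxPlus F p) (D2Cris.Bmax F p) (galBmaxPlus σ tBmax) ^ k) hyt.symm
        _ = y * algebraMap (BmaxPlus F p) (D2Cris.Bmax F p) (galBmaxPlus σ tBmax) ^ k *
            algebraMap (BmaxPlus F p) (D2Cris.Bmax F p) tBmax ^ k := mul_right_comm _ _ _
    have h1 : algebraMap (BmaxPlus F p) (D2Cris.Bmax F p) (galBmaxPlus σ a) =
        y * algebraMap (BmaxPlus F p) (D2Cris.Bmax F p) (galBmaxPlus σ tBmax) ^ k := hT.mul_left_inj.1 e2
    -- apply `σ` to `y · tᵏ = a`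
    have h2 := congrArg (D2Cris.galBmax (F := F) (p := p) σ) hyt
    simp only [map_mul, map_pow, D2Cris.galBmax_algebraMap, h1] at h2
    exact hS.mul_left_inj.1 h2
  obtain ⟨c, hc⟩ := (forall_galBmax_iff_mem_range hp hF y).1 hy
  have hc₁ : algebraMap (BDeRhamPlus (integerC F) p) (FracBdR F p) (embBdRHom hp hF c) = bmaxToFracBdR hF y := hc
  refine ⟨c, ?_⟩
  have e3 := congrArg (bmaxToFracBdR (F := F) (p := p) hF) hyt
  simp only [map_mul, map_pow, bmaxToFracBdR_algebraMap, bmaxPlusToBdR_tBmax] at e3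
  rw [← hc₁] at e3
  exact e3.symm

end Invariants

end SpecC

end Summit.Langlands.Langlands.Theorems

end
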